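import Summits.ValiantsHypothesis.ValiantsHypothesis.Theorems.KPlusLogSqLawTridiagonalRealStaticUnitFourBlock

/-!
# Route «KPlusLogSqLaw», crux `WeakLifting` (stmt-ValiantsHypothesis-19561) — REAL side of the tridiagonal sector:
# the UNIT-COEFFICIENT sub-sector at size `5` is EXACTLY FOUR: `U 5 = 4` (the located conjecture `U 5 = 3` is false)

HONEST FRAMING.  Helper theorems (`--supports stmt-ValiantsHypothesis-19561 --as helper`), seat val-sym-lift-p1 (g16), cell `pub-symmetroid`,
2026-08-28; closes the `m = 5` row of the unit sub-sector series (`…UnitSmall`: resonance law, `U 3 = 1`, `U 4 = 2`; `…UnitShadow` p601719: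
`U 5 ≥ 3`; `…UnitFive` p605854/p607165: `Z ≤ 2` unless the outer slopes are strictly opposite, `Z ≤ 3` if they are exactly opposite; `…UnitRows`:
floors to `m = 11`; `…UnitFourBlock`: the Descartes bookkeeping used here).  Currency `StaticTridiagonalRealPotential.pathDet (fun _ => 1) d (fun _ => 1) f 5`
(diagonal `X^{d_t}`, links `X^{f_t}`, all coefficients `1`); edge slopes `L_t = 2f_t − d_t − d_{t+1}`; `U 5` := the largest number of distinct
positive determinant zeros.  Proved here, for ALL exponent data:
* **DEFLATION** (`unit_five_eq_X_sub_one_mul`, `…mul'`): when the outer slopes are strictly opposite (`L₀ = a > 0 > L₃ = −e` or the mirror) the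
  determinant is `(X − 1)` times a signed sum of FOUR shifted blocks of consecutive unit coefficients, two of each sign — for `L₀ > 0 > L₃`:
  `X^{d₀+d₁+d₂+2f₃}[e] − X^{2f₀+d₂+2f₃}[e] + X^{d₀+d₁+2f₂+d₄}[a] − X^{d₀+2f₁+2f₃}[e]`, `[k] = 1 + X + ⋯ + X^{k−1}` (the resonance zero `x = 1` of
  the size-`5` resonance law divided out; the blocks are the matchings `{e₃}, {e₀,e₃}, {e₂}, {e₁,e₃}` of the path);
* **`U 5 ≤ 4`** (`card_posRoots_unit_five_le_four`): by the four-block lemma the cofactor has `Var ≤ 3`, so Descartes leaves at most three zeros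
  off `x = 1`; together with `…UnitFive` (at most two zeros when `L₀L₃ ≥ 0`) EVERY unit `5 × 5` design has at most four distinct positive zeros;
* **`U 5 ≥ 4`** (`four_le_card_posRoots_unit_five_witness`): the design with diagonal `(1, 1, X⁵¹, X¹⁷, X)` and links `(X⁷, 1, 1, X)` (edge slopes
  `L = (14, −51, −68, −16)`) has determinant `X⁶⁹ − X⁸³ − X¹⁸ − X + X¹⁵ − X⁵³ + X⁶⁷ + X²` with signs `− + − + −` at `19/20, 22/23, 32/33, 49/50, 2`:
  THREE zeros in `(19/20, 49/50)` (≈ `0.9531, 0.9619, 0.9776`) and the resonance zero `x = 1`;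
* hence **`U 5 = 4`** (`exists_unit_five_card_eq_four`).
So the located conjecture «`U m = ⌈m/2⌉`» of the seat memos (exact Sturm censuses of the box `L ∈ [−4,4]⁴` and of ≈ 10⁵ random designs with
`|L_t| ≤ 60`) is FALSE at `m = 5`, and so is «each side of `x = 1` carries at most two zeros»: the third off-resonance zero lives in the alternating
regime `L₁ ≤ −1`, `L₂ + e + 1 ≤ L₁`, `L₂ + e + a ≤ −1`, `a − L₁ ≥ e + 1` (with `a = L₀ < e = −L₃`) and needs `e/a = 1 + O(1/a)` with `|L₁| ≳ 3e`,
where the deflated equation `x^{L₁−L₂−e}·[e]ₓ/[a]ₓ = 1 + x^{−L₂−e}(1 − x^e)` lets the bump on the right cross the slowly rising left side twice more —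
far outside every censused box (smallest witnesses have determinant degree `82`).  In the two other alternating regimes (`L₂ ≥ 1` with
`L₁ ≥ max(L₂, a) + e + 1` or `L₁ + e ≤ a − 1`) a monotone splitting gives at most ONE zero off `x = 1` (seat notes; not needed here).
Nothing here is an upper law for the register (α NO MOVER); nothing bears on `WeakLifting` / `TropicalB` (stmt-19771) in their windows,
Conjecture B, the Door-A registers, `MatrixDescartes` (stmt-18050) or VP ≠ VNP.
[this seat; folklore: continuants ↔ matchings of the path, Descartes' rule of signs, IVT sign certificates]
-/

-- `Summit.ValiantsHypothesis.ValiantsHypothesis.…` repeats a component by the D-0017 layout (single-conjunct summit); the name is mandated.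
set_option linter.dupNamespace false
set_option autoImplicit false

namespace Summit.ValiantsHypothesis.ValiantsHypothesis.Theorems.KPlusLogSqLaw
namespace StaticTridiagonalRealUnit

open Polynomial Finset
open Summit.ValiantsHypothesis.ValiantsHypothesis.Theorems.KPlusLogSqLaw.StaticTridiagonalRealPotential (pathDet)
open Summit.ValiantsHypothesis.ValiantsHypothesis.Theorems.SymmetroidDescartes (le_card_posRoots_of_alternating)

/-! ### Deflation by the resonance zero `x = 1` -/

variable (d : ℕ → ℕ) (f : ℕ → ℕ)

/-- **deflation by the resonance zero** for `L₀ = a > 0 > L₃ = −e`: `D₅ = (X − 1)·(X^{E+a−e}·X^{?}…)`, precisely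
`D₅ = (X − 1)·(X^{E₅}[e] − X^{E₆}[e] + X^{E₃}[a] − X^{E₇}[e])` with `[n] = 1 + X + ⋯ + X^{n−1}`, `E₅ = d₀+d₁+d₂+2f₃`, `E₆ = 2f₀+d₂+2f₃`,
`E₃ = d₀+d₁+2f₂+d₄`, `E₇ = d₀+2f₁+2f₃` (the matchings `{e₃}`, `{e₀,e₃}`, `{e₂}`, `{e₁,e₃}` of the path). [this file] -/
theorem unit_five_eq_X_sub_one_mul (a e : ℕ) (h0 : 2 * f 0 = a + d 0 + d 1) (h3 : 2 * f 3 + e = d 3 + d 4) :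
    pathDet (fun _ => (1 : ℝ)) d (fun _ => (1 : ℝ)) f 5 =
      (X - C 1) * ((X : ℝ[X]) ^ (d 0 + d 1 + d 2 + 2 * f 3) * ∑ i ∈ range e, (X : ℝ[X]) ^ i -
        X ^ (2 * f 0 + d 2 + 2 * f 3) * ∑ i ∈ range e, (X : ℝ[X]) ^ i +
        X ^ (d 0 + d 1 + 2 * f 2 + d 4) * ∑ i ∈ range a, (X : ℝ[X]) ^ i -
        X ^ (d 0 + 2 * f 1 + 2 * f 3) * ∑ i ∈ range e, (X : ℝ[X]) ^ i) := by
  refine Polynomial.funext fun x => ?_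
  rw [eval_unit_five]
  simp only [eval_mul, eval_sub, eval_add, eval_pow, eval_X, eval_C, eval_finsetSum]
  have ge := geom_sum_mul x e
  have ga := geom_sum_mul x a
  have key : (x - 1) * (x ^ (d 0 + d 1 + d 2 + 2 * f 3) * ∑ i ∈ range e, x ^ i -
        x ^ (2 * f 0 + d 2 + 2 * f 3) * ∑ i ∈ range e, x ^ i +
        x ^ (d 0 + d 1 + 2 * f 2 + d 4) * ∑ i ∈ range a, x ^ i -
        x ^ (d 0 + 2 * f 1 + 2 * f 3) * ∑ i ∈ range e, x ^ i) =
      x ^ (d 0 + d 1 + d 2 + 2 * f 3) * ((∑ i ∈ range e, x ^ i) * (x - 1)) -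
        x ^ (2 * f 0 + d 2 + 2 * f 3) * ((∑ i ∈ range e, x ^ i) * (x - 1)) +
        x ^ (d 0 + d 1 + 2 * f 2 + d 4) * ((∑ i ∈ range a, x ^ i) * (x - 1)) -
        x ^ (d 0 + 2 * f 1 + 2 * f 3) * ((∑ i ∈ range e, x ^ i) * (x - 1)) := by ring
  rw [key, ge, ga]
  have e1 : x ^ (d 0 + d 1 + d 2 + 2 * f 3) * x ^ e = x ^ (d 4 + (d 3 + (d 2 + (d 1 + d 0)))) := by
    rw [← pow_add]; congr 1; omega
  have e2 : x ^ (2 * f 0 + d 2 + 2 * f 3) * x ^ e = x ^ (d 4 + (d 3 + (d 2 + 2 * f 0))) := by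
    rw [← pow_add]; congr 1; omega
  have e3 : x ^ (d 0 + d 1 + 2 * f 2 + d 4) * x ^ a = x ^ (d 4 + (2 * f 2 + 2 * f 0)) := by
    rw [← pow_add]; congr 1; omega
  have e4 : x ^ (d 0 + 2 * f 1 + 2 * f 3) * x ^ e = x ^ (d 4 + (d 3 + (2 * f 1 + d 0))) := by
    rw [← pow_add]; congr 1; omega
  have e5 : x ^ (d 0 + d 1 + d 2 + 2 * f 3) = x ^ (2 * f 3 + (d 2 + (d 1 + d 0))) := by congr 1; omega
  have e6 : x ^ (2 * f 0 + d 2 + 2 * f 3) = x ^ (2 * f 3 + (d 2 + 2 * f 0)) := by congr 1; omega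
  have e7 : x ^ (d 0 + d 1 + 2 * f 2 + d 4) = x ^ (d 4 + (2 * f 2 + (d 1 + d 0))) := by congr 1; omega
  have e8 : x ^ (d 0 + 2 * f 1 + 2 * f 3) = x ^ (2 * f 3 + (2 * f 1 + d 0)) := by congr 1; omega
  have k2 : ∀ (P : ℝ) (n : ℕ), P * (x ^ n - 1) = P * x ^ n - P := fun P n => by ring
  rw [k2, k2, k2, k2, e1, e2, e3, e4, e5, e6, e7, e8]
  ring

/-- the mirror deflation for `L₀ = −a < 0 < L₃ = e`: `D₅ = (X − 1)·(X^{E₁}[e] − X^{E₀}[e] + X^{E₂}[e] − X^{E₄}[a])`, `E₁ = 2f₀+d₂+d₃+d₄`,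
`E₀ = Σ d_t`, `E₂ = d₀+2f₁+d₃+d₄`, `E₄ = 2f₀+2f₂+d₄`. [this file] -/
theorem unit_five_eq_X_sub_one_mul' (a e : ℕ) (h0 : 2 * f 0 + a = d 0 + d 1) (h3 : 2 * f 3 = e + d 3 + d 4) :
    pathDet (fun _ => (1 : ℝ)) d (fun _ => (1 : ℝ)) f 5 =
      (X - C 1) * ((X : ℝ[X]) ^ (2 * f 0 + d 2 + d 3 + d 4) * ∑ i ∈ range e, (X : ℝ[X]) ^ i -
        X ^ (d 0 + d 1 + d 2 + d 3 + d 4) * ∑ i ∈ range e, (X : ℝ[X]) ^ i +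
        X ^ (d 0 + 2 * f 1 + d 3 + d 4) * ∑ i ∈ range e, (X : ℝ[X]) ^ i -
        X ^ (2 * f 0 + 2 * f 2 + d 4) * ∑ i ∈ range a, (X : ℝ[X]) ^ i) := by
  refine Polynomial.funext fun x => ?_
  rw [eval_unit_five]
  simp only [eval_mul, eval_sub, eval_add, eval_pow, eval_X, eval_C, eval_finsetSum]
  have ge := geom_sum_mul x e
  have ga := geom_sum_mul x a
  have key : (x - 1) * (x ^ (2 * f 0 + d 2 + d 3 + d 4) * ∑ i ∈ range e, x ^ i -
        x ^ (d 0 + d 1 + d 2 + d 3 + d 4) * ∑ i ∈ range e, x ^ i +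
        x ^ (d 0 + 2 * f 1 + d 3 + d 4) * ∑ i ∈ range e, x ^ i -
        x ^ (2 * f 0 + 2 * f 2 + d 4) * ∑ i ∈ range a, x ^ i) =
      x ^ (2 * f 0 + d 2 + d 3 + d 4) * ((∑ i ∈ range e, x ^ i) * (x - 1)) -
        x ^ (d 0 + d 1 + d 2 + d 3 + d 4) * ((∑ i ∈ range e, x ^ i) * (x - 1)) +
        x ^ (d 0 + 2 * f 1 + d 3 + d 4) * ((∑ i ∈ range e, x ^ i) * (x - 1)) -
        x ^ (2 * f 0 + 2 * f 2 + d 4) * ((∑ i ∈ range a, x ^ i) * (x - 1)) := by ring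
  rw [key, ge, ga]
  have e1 : x ^ (2 * f 0 + d 2 + d 3 + d 4) * x ^ e = x ^ (2 * f 3 + (d 2 + 2 * f 0)) := by
    rw [← pow_add]; congr 1; omega
  have e2 : x ^ (d 0 + d 1 + d 2 + d 3 + d 4) * x ^ e = x ^ (2 * f 3 + (d 2 + (d 1 + d 0))) := by
    rw [← pow_add]; congr 1; omega
  have e3 : x ^ (d 0 + 2 * f 1 + d 3 + d 4) * x ^ e = x ^ (2 * f 3 + (2 * f 1 + d 0)) := by
    rw [← pow_add]; congr 1; omega
  have e4 : x ^ (2 * f 0 + 2 * f 2 + d 4) * x ^ a = x ^ (d 4 + (2 * f 2 + (d 1 + d 0))) := by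
    rw [← pow_add]; congr 1; omega
  have e5 : x ^ (2 * f 0 + d 2 + d 3 + d 4) = x ^ (d 4 + (d 3 + (d 2 + 2 * f 0))) := by congr 1; omega
  have e6 : x ^ (d 0 + d 1 + d 2 + d 3 + d 4) = x ^ (d 4 + (d 3 + (d 2 + (d 1 + d 0)))) := by congr 1; omega
  have e7 : x ^ (d 0 + 2 * f 1 + d 3 + d 4) = x ^ (d 4 + (d 3 + (2 * f 1 + d 0))) := by congr 1; omega
  have e8 : x ^ (2 * f 0 + 2 * f 2 + d 4) = x ^ (d 4 + (2 * f 2 + 2 * f 0)) := by congr 1; omega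
  have k2 : ∀ (P : ℝ) (n : ℕ), P * (x ^ n - 1) = P * x ^ n - P := fun P n => by ring
  rw [k2, k2, k2, k2, e1, e2, e3, e4, e5, e6, e7, e8]
  ring

/-! ### The law `U 5 ≤ 4` and its sharpness -/

/-- **`U 5 ≤ 4` (kernel, all exponents)**: every unit-coefficient static symmetric tridiagonal `5 × 5` design has at most FOUR distinct positive
determinant zeros.  Outer slopes of one sign or zero: at most two (`…UnitFive`, p605854); strictly opposite outer slopes: `x = 1` and at most three
zeros of the deflated four-block polynomial (Descartes + the four-block lemma). [this file] -/
theorem card_posRoots_unit_five_le_four :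
    ((pathDet (fun _ => (1 : ℝ)) d (fun _ => (1 : ℝ)) f 5).roots.toFinset.filter (fun x => 0 < x)).card ≤ 4 := by
  by_cases h : 0 ≤ ((2 * f 0 : ℤ) - d 0 - d 1) * ((2 * f 3 : ℤ) - d 3 - d 4)
  · exact (card_posRoots_unit_five_le_two_of_outer d f h).trans (by norm_num)
  · rcases lt_or_ge 0 ((2 * f 0 : ℤ) - d 0 - d 1) with h0 | h0
    · -- `L₀ > 0`, hence `L₃ < 0`
      have h3 : (2 * f 3 : ℤ) - d 3 - d 4 < 0 := by
        by_contra h3; exact h (mul_nonneg h0.le (not_lt.1 h3))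
      obtain ⟨a, ha⟩ : ∃ a : ℕ, ((2 * f 0 : ℤ) - d 0 - d 1) = a := ⟨_, (Int.toNat_of_nonneg h0.le).symm⟩
      obtain ⟨e, he⟩ : ∃ e : ℕ, (d 3 : ℤ) + d 4 - 2 * f 3 = e := ⟨_, (Int.toNat_of_nonneg (by omega)).symm⟩
      exact card_posRoots_le_four_of_eq_mul_fourBlock _ _ _ _ _ e e a e
        (unit_five_eq_X_sub_one_mul d f a e (by omega) (by omega))
    · -- `L₀ ≤ 0`; as `L₀ L₃ < 0`, in fact `L₀ < 0 < L₃`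
      have h0' : (2 * f 0 : ℤ) - d 0 - d 1 < 0 := by
        rcases h0.lt_or_eq with h0 | h0
        · exact h0
        · exfalso; exact h (by rw [h0, zero_mul])
      have h3 : 0 < (2 * f 3 : ℤ) - d 3 - d 4 := by
        by_contra h3; exact h (mul_nonneg_of_nonpos_of_nonpos h0 (not_lt.1 h3))
      obtain ⟨a, ha⟩ : ∃ a : ℕ, (d 0 : ℤ) + d 1 - 2 * f 0 = a := ⟨_, (Int.toNat_of_nonneg (by omega)).symm⟩
      obtain ⟨e, he⟩ : ∃ e : ℕ, ((2 * f 3 : ℤ) - d 3 - d 4) = e := ⟨_, (Int.toNat_of_nonneg h3.le).symm⟩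
      exact card_posRoots_le_four_of_eq_mul_fourBlock _ _ _ _ _ e e e a
        (unit_five_eq_X_sub_one_mul' d f a e (by omega) (by omega))

/-- the witness design of size `5`: diagonal `(1, 1, X⁵¹, X¹⁷, X)`, links `(X⁷, 1, 1, X)` (edge slopes `L = (14, −51, −68, −16)`):
`D₅ = X⁶⁹ − X⁸³ − X¹⁸ − X + X¹⁵ − X⁵³ + X⁶⁷ + X²`. [this file] -/
theorem eval_unit_five_witness (x : ℝ) :
    (pathDet (fun _ => (1 : ℝ)) (fun t => if t = 2 then 51 else if t = 3 then 17 else if t = 4 then 1 else 0)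
        (fun _ => (1 : ℝ)) (fun t => if t = 0 then 7 else if t = 3 then 1 else 0) 5).eval x =
      x ^ 69 - x ^ 83 - x ^ 18 - x + x ^ 15 - x ^ 53 + x ^ 67 + x ^ 2 := by
  rw [eval_unit_five]
  norm_num

/-- **`U 5 ≥ 4`**: the witness design has at least FOUR distinct positive determinant zeros — signs `− + − + −` at `19/20, 22/23, 32/33, 49/50, 2`
(three zeros in `(19/20, 49/50)` and the resonance zero `x = 1`). [this file] -/
theorem four_le_card_posRoots_unit_five_witness :
    4 ≤ ((pathDet (fun _ => (1 : ℝ)) (fun t => if t = 2 then 51 else if t = 3 then 17 else if t = 4 then 1 else 0)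
        (fun _ => (1 : ℝ)) (fun t => if t = 0 then 7 else if t = 3 then 1 else 0) 5).roots.toFinset.filter
        (fun x => 0 < x)).card := by
  refine le_card_posRoots_of_alternating _ 4 (![19 / 20, 22 / 23, 32 / 33, 49 / 50, 2] : Fin 5 → ℝ) ?_ ?_ ?_
  · refine Fin.strictMono_iff_lt_succ.2 fun j => ?_
    fin_cases j <;> norm_num [Matrix.cons_val_two, Matrix.tail_cons, Matrix.head_cons]
  · intro j; fin_cases j <;> norm_num [Matrix.cons_val_two, Matrix.tail_cons, Matrix.head_cons]
  · intro j; fin_cases j <;> norm_num [Matrix.cons_val_two, Matrix.tail_cons, Matrix.head_cons, eval_unit_five_witness]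

/-- **`U 5 = 4` EXACTLY (kernel)**: the largest number of distinct positive determinant zeros of a unit-coefficient static symmetric tridiagonal
`5 × 5` design is four — attained by the witness (`L = (14, −51, −68, −16)`), never exceeded (`card_posRoots_unit_five_le_four`).  This REFUTES the
located conjecture `U m = ⌈m/2⌉` at `m = 5`. [this file] -/
theorem exists_unit_five_card_eq_four :
    (∃ d f : ℕ → ℕ, ((pathDet (fun _ => (1 : ℝ)) d (fun _ => (1 : ℝ)) f 5).roots.toFinset.filter (fun x => 0 < x)).card = 4) ∧
      ∀ d f : ℕ → ℕ, ((pathDet (fun _ => (1 : ℝ)) d (fun _ => (1 : ℝ)) f 5).roots.toFinset.filter (fun x => 0 < x)).card ≤ 4 :=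
  ⟨⟨_, _, le_antisymm (card_posRoots_unit_five_le_four _ _) four_le_card_posRoots_unit_five_witness⟩,
    card_posRoots_unit_five_le_four⟩

end StaticTridiagonalRealUnit
end Summit.ValiantsHypothesis.ValiantsHypothesis.Theorems.KPlusLogSqLaw
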